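import Literature.AlgebraicGeometry.Motives.MixedHodgeStructureSplitOverQGraded
import Literature.AlgebraicGeometry.Motives.MixedHodgeStructureHodgeTateRationalSplitting
import HarnessLib

/-!
# A Hodge–Tate structure is split over `ℚ` iff its period operator can be made trivial

Marcolli, *Feynman motives*, (2.49)–(2.51): for a Hodge–Tate structure `M` choose `ℚ`-linear splittings
`s_p : gr^W_{2p} M → W_{2p} M` of the weight filtration; `S_W = Σ (s_p)_ℂ`, `S_HT` is the canonical
splitting through the `I^{p,p}`, and the period operator / matrix is `P = S_HT⁻¹ ∘ S_W` (the tree's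
`rationalSplittingMap`, `IsHodgeTate.grSplitting`, `IsHodgeTate.periodOperator`); `M` "is" `⊕ ℚ(-p)` exactly
when the periods are trivial. Goncharov, *Multiple polylogarithms and mixed Tate motives*, §4.1 (framed
mixed Tate objects and their period matrices). Green–Griffiths–Kerr, §I.C (I.C.8): the Deligne splitting is
defined over `ℂ` only, unless the MHS is `ℚ`-split.

For a Hodge–Tate structure `H` on a finite-dimensional `V` this file proves:

* §1 **Hodge sections**: a `ℚ`-linear section `s_p` of `W_{2p} ↠ Gr^W_{2p}` is a *Hodge section* when
  `1 ⊗ s_p(x) ∈ F^p` for all `x` (`IsHodgeSection`); then `(s_p)_ℂ` IS the canonical `σ_p`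
  (`IsHodgeTate.grIncl_baseChange_eq_grSection`), i.e. `S_W = S_HT` on the `p`-th summand.
* §2 **`H` is split over `ℚ` iff it admits Hodge sections in every even weight**
  (`IsHodgeTate.isSplitOverQ_iff_exists_hodgeSections`): (⇒) invert `U_{2p} ⥲ Gr^W_{2p}`; (⇐) the `ℚ`-span
  `U_p = s_p(Gr^W_{2p})` has `(U_p)_ℂ ⊆ F^p ∩ W_{2p,ℂ} = I^{p,p}` with equal dimensions.
* §3 **`H` is split over `ℚ` iff `P = id` for some family of rational sections**
  (`IsHodgeTate.isSplitOverQ_iff_exists_periodOperator_eq_id`; `S_W = S_HT`,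
  `IsHodgeTate.rationalSplittingMap_eq_grSplitting`).

All statements proved; one definition (`IsHodgeSection`, a `Prop` with body about a given section — not a
named fact); no instances.

## References

* [Marcolli2009] M. Marcolli, Feynman motives (2010), (2.49)–(2.51) (held text p0088–p0089).
* [Goncharov2001MultiplePolylogarithms] A. B. Goncharov, Multiple polylogarithms and mixed Tate motives
  (2001), §4.1.
* [GreenGriffithsKerr2012] M. Green, P. Griffiths, M. Kerr, Mumford–Tate groups and domains (2012), §I.C (I.C.8).
-/

noncomputable section

open scoped TensorProduct
open Module

namespace Literature.AlgebraicGeometry.Motives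

namespace MixedHodgeStructure

open Literature.LinearAlgebra.BaseChange (baseChange_range)

universe u

variable {V : Type u} [AddCommGroup V] [Module ℚ V]

/-! ### §1 Hodge sections of `W_{2p} ↠ Gr^W_{2p}` -/

/-- A `ℚ`-linear map `s : Gr^W_{2p} H → W_{2p} H` is a **Hodge section** if it is a section of the projection
and its values lie in `F^p` after complexification (`1 ⊗ s(x) ∈ F^p H`): the `p`-th column of Marcolli's
period matrix is then trivial. [cite: Marcolli2009, (2.49)–(2.51)] -/
def IsHodgeSection (H : MixedHodgeStructure V) (p : ℤ) (s : grW H.W (2 * p) →ₗ[ℚ] ↥(H.W (2 * p))) : Prop :=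
  (subPiece H.W (2 * p)).mkQ ∘ₗ s = LinearMap.id ∧ ∀ x, (1 : ℂ) ⊗ₜ[ℚ] ((s x : ↥(H.W (2 * p))) : V) ∈ H.F p

namespace IsHodgeSection

variable {H : MixedHodgeStructure V} {p : ℤ} {s : grW H.W (2 * p) →ₗ[ℚ] ↥(H.W (2 * p))}

/-- A Hodge section is a section. [cite: Marcolli2009, (2.49)] -/
theorem mkQ_comp (hs : H.IsHodgeSection p s) : (subPiece H.W (2 * p)).mkQ ∘ₗ s = LinearMap.id := hs.1

/-- A Hodge section is injective. [cite: Marcolli2009, (2.49)] -/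
theorem injective (hs : H.IsHodgeSection p s) : Function.Injective s :=
  Function.LeftInverse.injective (g := (subPiece H.W (2 * p)).mkQ) fun x => by
    rw [← LinearMap.comp_apply, hs.1, LinearMap.id_apply]

/-- **The complexified values of a Hodge section lie in `I^{p,p} = F^p ∩ W_{2p,ℂ}`.** [cite: Marcolli2009, (2.49)] -/
theorem grIncl_baseChange_mem_deligneI [FiniteDimensional ℚ V] (hs : H.IsHodgeSection p s) (ht : H.IsHodgeTate)
    (x : ℂ ⊗[ℚ] grW H.W (2 * p)) : grIncl H.W (2 * p) ((s.baseChange ℂ) x) ∈ H.deligneI p p := by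
  rw [← ht.F_inf_baseChange_W p]
  refine ⟨?_, ?_⟩
  · induction x using TensorProduct.induction_on with
    | zero => rw [map_zero, map_zero]; exact Submodule.zero_mem _
    | tmul a y =>
      rw [LinearMap.baseChange_tmul, show a ⊗ₜ[ℚ] s y = a • ((1 : ℂ) ⊗ₜ[ℚ] s y) by
        rw [TensorProduct.smul_tmul', smul_eq_mul, mul_one], map_smul]
      refine Submodule.smul_mem _ a ?_
      rw [show grIncl H.W (2 * p) ((1 : ℂ) ⊗ₜ[ℚ] s y) = (1 : ℂ) ⊗ₜ[ℚ] ((s y : ↥(H.W (2 * p))) : V) from rfl]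
      exact hs.2 y
    | add x y hx hy => rw [map_add, map_add]; exact Submodule.add_mem _ hx hy
  · rw [← range_grIncl]
    exact LinearMap.mem_range_self _ _

/-- **For a Hodge section `(s_p)_ℂ = σ_p`**: the complexification of `s_p` (followed by `W_{2p,ℂ} ⊆ V_ℂ`) is
the canonical Hodge–Tate section `σ_p` (`IsHodgeTate.grSection`). [cite: Marcolli2009, (2.49)] -/
theorem grIncl_baseChange_eq_grSection [FiniteDimensional ℚ V] (hs : H.IsHodgeSection p s) (ht : H.IsHodgeTate)
    (x : ℂ ⊗[ℚ] grW H.W (2 * p)) : grIncl H.W (2 * p) ((s.baseChange ℂ) x) = ht.grSection p x := by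
  have h := ht.eq_grSection_of_sub_mem p (hs.grIncl_baseChange_mem_deligneI ht x) ((s.baseChange ℂ) x)
    (by rw [sub_self]; exact Submodule.zero_mem _)
  rwa [grProj_baseChange_section s hs.1 x] at h

end IsHodgeSection

/-! ### §2 `ℚ`-split ⟺ Hodge sections exist -/

variable [FiniteDimensional ℚ V] {H : MixedHodgeStructure V}

/-- **A `ℚ`-split Hodge–Tate structure has Hodge sections**: invert `U_{2p} ⥲ Gr^W_{2p}`
(`IsSplitOverQ.weightPieceGrHom`) and include `U_{2p} ⊆ W_{2p}`; the values lie in `(U_{2p})_ℂ = I^{p,p} ⊆ F^p`.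
[cite: Marcolli2009, (2.49)] -/
theorem IsSplitOverQ.exists_isHodgeSection (h : H.IsSplitOverQ) (ht : H.IsHodgeTate) (p : ℤ) :
    ∃ s, H.IsHodgeSection p s := by
  let e := LinearEquiv.ofBijective _ (h.weightPieceGrHom_bijective (2 * p))
  refine ⟨Submodule.inclusion (h.weightForm_le_W (2 * p)) ∘ₗ (e.symm.toLinearMap : grW H.W (2 * p) →ₗ[ℚ] ↥(h.weightForm (2 * p))),
    LinearMap.ext fun x => ?_, fun x => ?_⟩
  · change (h.weightPieceGrHom (2 * p)).toLinearMap (e.symm x) = x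
    exact e.apply_symm_apply x
  · have hx : ((e.symm x : ↥(h.weightForm (2 * p))) : V) ∈ h.weightForm (2 * p) := (e.symm x).2
    have h1 := Submodule.tmul_mem_baseChange_of_mem (1 : ℂ) hx
    rw [h.baseChange_weightForm, ht.deligneE_two_mul p] at h1
    exact H.deligneI_le_F p p h1

/-- **Hodge sections make a Hodge–Tate structure `ℚ`-split**: `U_p := s_p(Gr^W_{2p}) ⊆ V` is a `ℚ`-form of
`I^{p,p}` (`(U_p)_ℂ ⊆ F^p ∩ W_{2p,ℂ} = I^{p,p}` and `dim U_p = dim Gr^W_{2p} = h^{p,p} = dim I^{p,p}`).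
[cite: Marcolli2009, (2.49)–(2.51)] -/
theorem IsHodgeTate.baseChange_map_range_eq_deligneI (ht : H.IsHodgeTate) {p : ℤ}
    {s : grW H.W (2 * p) →ₗ[ℚ] ↥(H.W (2 * p))} (hs : H.IsHodgeSection p s) :
    ((LinearMap.range s).map (H.W (2 * p)).subtype).baseChange ℂ = H.deligneI p p := by
  have hle : ((LinearMap.range s).map (H.W (2 * p)).subtype).baseChange ℂ ≤ H.deligneI p p := by
    rw [Submodule.baseChange_eq_span]
    refine Submodule.span_le.2 ?_
    rintro _ ⟨v, hv, rfl⟩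
    obtain ⟨_, ⟨x, rfl⟩, rfl⟩ := hv
    have h1 := hs.grIncl_baseChange_mem_deligneI ht ((1 : ℂ) ⊗ₜ[ℚ] x)
    rwa [LinearMap.baseChange_tmul] at h1
  refine Submodule.eq_of_le_of_finrank_eq hle ?_
  -- `dim_ℂ (U_p)_ℂ = dim_ℚ U_p = dim Gr^W_{2p} = h^{p,p} = dim I^{p,p}`
  have hU : finrank ℂ (((LinearMap.range s).map (H.W (2 * p)).subtype).baseChange ℂ) =
      finrank ℚ ((LinearMap.range s).map (H.W (2 * p)).subtype) := by
    rw [← Submodule.range_subtype ((LinearMap.range s).map (H.W (2 * p)).subtype), baseChange_range ℂ,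
      LinearMap.finrank_range_of_inj (baseChange_injective (Submodule.injective_subtype _)),
      Module.finrank_baseChange, Submodule.range_subtype]
  rw [hU, LinearEquiv.finrank_eq (Submodule.equivMapOfInjective _ (Submodule.injective_subtype _) _).symm,
    LinearMap.finrank_range_of_inj hs.injective, finrank_deligneI_eq_hodgeNumber, ht.hodgeNumber_diag_eq_finrank_grW]

/-- **A Hodge–Tate structure is split over `ℚ` iff it admits a Hodge section in every even weight.**
[cite: Marcolli2009, (2.49)–(2.51)] -/
theorem IsHodgeTate.isSplitOverQ_iff_exists_hodgeSections (ht : H.IsHodgeTate) :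
    H.IsSplitOverQ ↔ ∀ p : ℤ, ∃ s, H.IsHodgeSection p s := by
  refine ⟨fun h p => h.exists_isHodgeSection ht p, fun h => ht.isSplitOverQ_iff.2 fun p => ?_⟩
  obtain ⟨s, hs⟩ := h p
  exact ⟨_, ht.baseChange_map_range_eq_deligneI hs⟩

/-! ### §3 `ℚ`-split ⟺ trivial period operator -/

/-- **With Hodge sections `S_W = S_HT`**: Marcolli's complexified rational splitting coincides with the
canonical Hodge–Tate splitting. [cite: Marcolli2009, (2.49)–(2.51)] -/
theorem IsHodgeTate.rationalSplittingMap_eq_grSplitting (ht : H.IsHodgeTate)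
    {s : ∀ p : ℤ, grW H.W (2 * p) →ₗ[ℚ] ↥(H.W (2 * p))} (hs : ∀ p, H.IsHodgeSection p (s p)) :
    rationalSplittingMap H.W s = ht.grSplitting := by
  refine DirectSum.linearMap_ext ℂ fun p => LinearMap.ext fun x => ?_
  rw [LinearMap.comp_apply, LinearMap.comp_apply, rationalSplittingMap_lof, ht.grSplitting_lof]
  exact (hs p).grIncl_baseChange_eq_grSection ht x

/-- **With Hodge sections the period operator is the identity.** [cite: Marcolli2009, (2.49)–(2.51)] -/
theorem IsHodgeTate.periodOperator_eq_id (ht : H.IsHodgeTate)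
    {s : ∀ p : ℤ, grW H.W (2 * p) →ₗ[ℚ] ↥(H.W (2 * p))} (hs : ∀ p, H.IsHodgeSection p (s p)) :
    ht.periodOperator s = LinearMap.id := by
  refine LinearMap.ext fun y => ?_
  rw [ht.periodOperator_apply, ht.rationalSplittingMap_eq_grSplitting hs, ← ht.grSplittingEquiv_apply,
    LinearEquiv.symm_apply_apply, LinearMap.id_apply]

/-- **Conversely, sections with trivial period operator are Hodge sections** (`S_W = S_HT ∘ P = S_HT` takes
values in `⊕ I^{p,p} ⊆ F`). [cite: Marcolli2009, (2.49)–(2.51)] -/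
theorem IsHodgeTate.isHodgeSection_of_periodOperator_eq_id (ht : H.IsHodgeTate)
    {s : ∀ p : ℤ, grW H.W (2 * p) →ₗ[ℚ] ↥(H.W (2 * p))}
    (hs : ∀ p, (subPiece H.W (2 * p)).mkQ ∘ₗ s p = LinearMap.id) (hP : ht.periodOperator s = LinearMap.id) (p : ℤ) :
    H.IsHodgeSection p (s p) := by
  refine ⟨hs p, fun x => ?_⟩
  have h1 : rationalSplittingMap H.W s (DirectSum.lof ℂ ℤ (fun p => ℂ ⊗[ℚ] grW H.W (2 * p)) p ((1 : ℂ) ⊗ₜ[ℚ] x)) =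
      ht.grSection p ((1 : ℂ) ⊗ₜ[ℚ] x) := by
    rw [← ht.grSplitting_periodOperator s, hP, LinearMap.id_apply, ht.grSplitting_lof]
  rw [rationalSplittingMap_lof, LinearMap.baseChange_tmul] at h1
  have h2 : grIncl H.W (2 * p) ((1 : ℂ) ⊗ₜ[ℚ] (s p) x) ∈ H.F p := by
    rw [h1]
    exact ht.grSection_mem_F p _
  exact h2

/-- **A Hodge–Tate structure is split over `ℚ` iff its period operator is the identity for some family of
rational sections of the weight filtration** (Marcolli: trivial period matrix). [cite: Marcolli2009, (2.49)–(2.51)] -/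
theorem IsHodgeTate.isSplitOverQ_iff_exists_periodOperator_eq_id (ht : H.IsHodgeTate) :
    H.IsSplitOverQ ↔ ∃ s : ∀ p : ℤ, grW H.W (2 * p) →ₗ[ℚ] ↥(H.W (2 * p)),
      (∀ p, (subPiece H.W (2 * p)).mkQ ∘ₗ s p = LinearMap.id) ∧ ht.periodOperator s = LinearMap.id := by
  rw [ht.isSplitOverQ_iff_exists_hodgeSections]
  constructor
  · intro h
    choose s hs using h
    exact ⟨s, fun p => (hs p).1, ht.periodOperator_eq_id hs⟩
  · rintro ⟨s, hs, hP⟩ p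
    exact ⟨s p, ht.isHodgeSection_of_periodOperator_eq_id hs hP p⟩

end MixedHodgeStructure

end Literature.AlgebraicGeometry.Motives
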